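import Mathlib
import Summits.NavierStokesRegularity.NavierStokesRegularity.Theorems.SoloBlindIsotropicReduction

/-!
# Soloist (blind) rung: the degree-5 (S-iii) cascade and the positive-spanning sign lemma

Kernel skeleton of the two finite-dimensional steps by which §2.8 (S′) of the soloist report closes
total degree 5 of the first-order Lyapunov programme (THEOREM R with D′ = 5, LEMMAS Q/Q′):

* `const_nonpos_of_poly4_nonpos` : if `a + ε b + ε² c + ε³ d + ε⁴ e ≤ 0` for all `ε > 0` then `a ≤ 0`
  (an explicit small `ε`; no limits).
* `sIII_cascade_deg5` : from `ε·Q(ε) ≤ 0` on `(0,∞)` and `≥ 0` on `(−∞,0)` with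
  `Q(ε) = N₄₁ + ε N₃₂ + ε² N₂₃ + ε³ N₁₄ + ε⁴ N₀₅` one gets `N₄₁ ≤ 0`, and once `N₄₁ = 0`
  (which the isotropic reduction supplies) `N₃₂ = 0`, `N₂₃ ≤ 0`, `N₀₅ ≤ 0`, `N₁₄² ≤ 4 N₂₃ N₀₅`
  and `N₂₃ = 0 → N₁₄ = 0` — the degree-3 cascade `sIII_cascade_deg3` / `sIII_middle_vanishes`
  re-entered two rungs down.
* `both_signs_of_pos_span` : if finitely many vectors `r s ∈ ℝ^q` have every `± e_t` in their
  nonnegative span, then every nonzero linear functional `d` is `> 0` on some `r s` and `< 0` on another —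
  the logical form of the exact witness certificates `cert_23.json` / `cert_05.json` (LEMMAS Q, Q′).
-/

set_option linter.dupNamespace false

namespace Summit.NavierStokesRegularity.NavierStokesRegularity.Theorems

open Finset

/-- If a real quartic `a + ε b + ε² c + ε³ d + ε⁴ e` is `≤ 0` for every `ε > 0`, its constant term is `≤ 0`
(take `ε = min 1 (a / (2M))`, `M = |b|+|c|+|d|+|e|+1`). -/
theorem const_nonpos_of_poly4_nonpos (a b c d e : ℝ)
    (h : ∀ ε : ℝ, 0 < ε → a + ε * b + ε ^ 2 * c + ε ^ 3 * d + ε ^ 4 * e ≤ 0) : a ≤ 0 := by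
  by_contra ha
  have ha' : 0 < a := not_le.mp ha
  set M : ℝ := |b| + |c| + |d| + |e| + 1 with hM
  have hMpos : 0 < M := by rw [hM]; positivity
  set ε : ℝ := min (1 : ℝ) (a / (2 * M)) with hε
  have hεpos : 0 < ε := lt_min one_pos (div_pos ha' (by positivity))
  have hε1 : ε ≤ 1 := min_le_left _ _
  have hεa : ε ≤ a / (2 * M) := min_le_right _ _
  have hεM : ε * M ≤ a / 2 := by
    have h1 : ε * M ≤ a / (2 * M) * M := mul_le_mul_of_nonneg_right hεa hMpos.le
    have h2 : a / (2 * M) * M = a / 2 := by field_simp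
    linarith
  have hεM' : ε * M = ε * |b| + ε * |c| + ε * |d| + ε * |e| + ε := by rw [hM]; ring
  have h2 : ε ^ 2 ≤ ε := by nlinarith
  have h3 : ε ^ 3 ≤ ε := by nlinarith
  have h4 : ε ^ 4 ≤ ε := by nlinarith
  have tb : -(ε * |b|) ≤ ε * b := by
    have := mul_le_mul_of_nonneg_left (neg_abs_le b) hεpos.le
    linarith
  have tc : -(ε * |c|) ≤ ε ^ 2 * c := by
    have h₁ := mul_le_mul_of_nonneg_left (neg_abs_le c) (pow_nonneg hεpos.le 2)
    have h₂ := mul_le_mul_of_nonneg_right h2 (abs_nonneg c)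
    linarith
  have td : -(ε * |d|) ≤ ε ^ 3 * d := by
    have h₁ := mul_le_mul_of_nonneg_left (neg_abs_le d) (pow_nonneg hεpos.le 3)
    have h₂ := mul_le_mul_of_nonneg_right h3 (abs_nonneg d)
    linarith
  have te : -(ε * |e|) ≤ ε ^ 4 * e := by
    have h₁ := mul_le_mul_of_nonneg_left (neg_abs_le e) (pow_nonneg hεpos.le 4)
    have h₂ := mul_le_mul_of_nonneg_right h4 (abs_nonneg e)
    linarith
  have := h ε hεpos
  linarith

/-- Mirror image: if the quartic is `≥ 0` for every `ε > 0`, its constant term is `≥ 0`. -/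
theorem const_nonneg_of_poly4_nonneg (a b c d e : ℝ)
    (h : ∀ ε : ℝ, 0 < ε → 0 ≤ a + ε * b + ε ^ 2 * c + ε ^ 3 * d + ε ^ 4 * e) : 0 ≤ a := by
  have := const_nonpos_of_poly4_nonpos (-a) (-b) (-c) (-d) (-e) (by
    intro ε hε; have := h ε hε; linarith)
  linarith

/-- THE DEGREE-5 (S-iii) CASCADE. With `Q(ε) = N₄₁ + ε N₃₂ + ε² N₂₃ + ε³ N₁₄ + ε⁴ N₀₅` and
`ε·Q(ε) ≤ 0` on `(0,∞)`, `≥ 0` on `(−∞,0)` (the top-degree identity of a monotone degree-5 density after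
the spreading and parity steps): `N₄₁ ≤ 0`; and if `N₄₁ = 0` then `N₃₂ = 0`, `N₂₃ ≤ 0`, `N₀₅ ≤ 0`,
`N₁₄² ≤ 4 N₂₃ N₀₅`, and `N₂₃ = 0 → N₁₄ = 0`. -/
theorem sIII_cascade_deg5 (N41 N32 N23 N14 N05 : ℝ)
    (hpos : ∀ ε : ℝ, 0 < ε → ε * (N41 + ε * N32 + ε ^ 2 * N23 + ε ^ 3 * N14 + ε ^ 4 * N05) ≤ 0)
    (hneg : ∀ ε : ℝ, ε < 0 → 0 ≤ ε * (N41 + ε * N32 + ε ^ 2 * N23 + ε ^ 3 * N14 + ε ^ 4 * N05)) :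
    N41 ≤ 0 ∧ (N41 = 0 → N32 = 0 ∧ N23 ≤ 0 ∧ N05 ≤ 0 ∧ N14 ^ 2 ≤ 4 * N23 * N05 ∧ (N23 = 0 → N14 = 0)) := by
  -- Q ≤ 0 away from 0
  have hQ : ∀ ε : ℝ, ε ≠ 0 → N41 + ε * N32 + ε ^ 2 * N23 + ε ^ 3 * N14 + ε ^ 4 * N05 ≤ 0 := by
    intro ε hε
    rcases lt_or_gt_of_ne hε with h | h
    · have := hneg ε h
      by_contra hc
      have hc' := not_le.mp hc
      have : ε * (N41 + ε * N32 + ε ^ 2 * N23 + ε ^ 3 * N14 + ε ^ 4 * N05) < 0 := mul_neg_of_neg_of_pos h hc'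
      linarith
    · have := hpos ε h
      by_contra hc
      have hc' := not_le.mp hc
      have : 0 < ε * (N41 + ε * N32 + ε ^ 2 * N23 + ε ^ 3 * N14 + ε ^ 4 * N05) := mul_pos h hc'
      linarith
  have h41 : N41 ≤ 0 := const_nonpos_of_poly4_nonpos N41 N32 N23 N14 N05 (fun ε hε => hQ ε (ne_of_gt hε))
  refine ⟨h41, ?_⟩
  intro h41z
  -- with N41 = 0: for ε > 0 the inner cubic-in-ε bracket is ≤ 0, for ε < 0 it is ≥ 0
  have hin_pos : ∀ ε : ℝ, 0 < ε → N32 + ε * N23 + ε ^ 2 * N14 + ε ^ 3 * N05 + ε ^ 4 * 0 ≤ 0 := by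
    intro ε hε
    have h1 := hQ ε (ne_of_gt hε)
    rw [h41z] at h1
    have h2 : ε * (N32 + ε * N23 + ε ^ 2 * N14 + ε ^ 3 * N05) ≤ 0 := by nlinarith
    by_contra hc
    have hc' : 0 < N32 + ε * N23 + ε ^ 2 * N14 + ε ^ 3 * N05 := by linarith [not_le.mp hc]
    have : 0 < ε * (N32 + ε * N23 + ε ^ 2 * N14 + ε ^ 3 * N05) := mul_pos hε hc'
    linarith
  have hin_neg : ∀ δ : ℝ, 0 < δ → 0 ≤ N32 + δ * (-N23) + δ ^ 2 * N14 + δ ^ 3 * (-N05) + δ ^ 4 * 0 := by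
    intro δ hδ
    have h1 := hQ (-δ) (by linarith)
    rw [h41z] at h1
    -- (-δ) * inner ≤ 0 with -δ < 0  ⟹ inner(-δ) ≥ 0
    have h2 : (-δ) * (N32 + (-δ) * N23 + (-δ) ^ 2 * N14 + (-δ) ^ 3 * N05) ≤ 0 := by nlinarith
    by_contra hc
    have hc' : N32 + (-δ) * N23 + (-δ) ^ 2 * N14 + (-δ) ^ 3 * N05 < 0 := by linarith [not_le.mp hc]
    have : 0 < (-δ) * (N32 + (-δ) * N23 + (-δ) ^ 2 * N14 + (-δ) ^ 3 * N05) := mul_pos_of_neg_of_neg (by linarith) hc'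
    linarith
  have h32a : N32 ≤ 0 := const_nonpos_of_poly4_nonpos N32 N23 N14 N05 0 hin_pos
  have h32b : 0 ≤ N32 := const_nonneg_of_poly4_nonneg N32 (-N23) N14 (-N05) 0 hin_neg
  have h32 : N32 = 0 := le_antisymm h32a h32b
  -- with N41 = N32 = 0:  P(ε) := N23 + ε N14 + ε² N05 ≤ 0 for ε ≠ 0, i.e. the degree-3 hypotheses
  have hP : ∀ ε : ℝ, ε ≠ 0 → N23 + ε * N14 + ε ^ 2 * N05 ≤ 0 := by
    intro ε hε
    have h1 := hQ ε hε
    rw [h41z, h32] at h1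
    have hε2 : 0 < ε ^ 2 := by positivity
    by_contra hc
    have hc' : 0 < N23 + ε * N14 + ε ^ 2 * N05 := not_le.mp hc
    have : 0 < ε ^ 2 * (N23 + ε * N14 + ε ^ 2 * N05) := mul_pos hε2 hc'
    nlinarith
  have hpos3 : ∀ ε : ℝ, 0 < ε → ε * (N23 + ε * N14 + ε ^ 2 * N05) ≤ 0 := by
    intro ε hε; have := hP ε (ne_of_gt hε); nlinarith
  have hneg3 : ∀ ε : ℝ, ε < 0 → 0 ≤ ε * (N23 + ε * N14 + ε ^ 2 * N05) := by
    intro ε hε; have := hP ε (ne_of_lt hε); nlinarith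
  obtain ⟨h23, h05, hdisc⟩ := sIII_cascade_deg3 N23 N14 N05 hpos3 hneg3
  exact ⟨h32, h23, h05, hdisc, fun h23z => sIII_middle_vanishes N23 N14 N05 hdisc h23z⟩

/-- POSITIVE SPANNING FORCES BOTH SIGNS (the logical form of the exact witness certificates of LEMMAS Q, Q′).
If vectors `r s : Fin q → ℝ`, `s : Fin n`, have every signed coordinate vector `σ e_t` (`σ = ±1`) in their
nonnegative span, then every nonzero `d : Fin q → ℝ` satisfies `d ⬝ r s > 0` for some `s` and `< 0` for another. -/
theorem both_signs_of_pos_span {n q : ℕ} (r : Fin n → Fin q → ℝ)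
    (hspan : ∀ t : Fin q, ∀ σ : ℝ, (σ = 1 ∨ σ = -1) →
      ∃ w : Fin n → ℝ, (∀ s, 0 ≤ w s) ∧ ∀ i, ∑ s, w s * r s i = σ * (if i = t then 1 else 0))
    (d : Fin q → ℝ) (hd : d ≠ 0) :
    (∃ s, 0 < ∑ i, d i * r s i) ∧ (∃ s, ∑ i, d i * r s i < 0) := by
  obtain ⟨t, ht⟩ := Function.ne_iff.mp hd
  have ht' : d t ≠ 0 := by simpa using ht
  -- key computation: for a nonnegative representation of σ e_t, Σ_s w_s (d ⬝ r_s) = σ d_t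
  have key : ∀ σ : ℝ, ∀ w : Fin n → ℝ, (∀ i, ∑ s, w s * r s i = σ * (if i = t then 1 else 0)) →
      ∑ s, w s * (∑ i, d i * r s i) = σ * d t := by
    intro σ w hw
    have : ∑ s, w s * (∑ i, d i * r s i) = ∑ i, d i * (∑ s, w s * r s i) := by
      simp_rw [Finset.mul_sum]
      rw [Finset.sum_comm]
      apply Finset.sum_congr rfl; intro i _; apply Finset.sum_congr rfl; intro s _; ring
    rw [this]
    simp_rw [hw]
    simp [Finset.sum_ite_eq', mul_comm]
  -- from Σ_s w_s x_s > 0 with w ≥ 0 get some x_s > 0; from < 0 get some x_s < 0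
  have pos_of : ∀ w : Fin n → ℝ, (∀ s, 0 ≤ w s) → 0 < ∑ s, w s * (∑ i, d i * r s i) →
      ∃ s, 0 < ∑ i, d i * r s i := by
    intro w hw hsum
    by_contra hc
    simp only [not_exists, not_lt] at hc
    have : ∑ s, w s * (∑ i, d i * r s i) ≤ 0 :=
      Finset.sum_nonpos (fun s _ => mul_nonpos_of_nonneg_of_nonpos (hw s) (hc s))
    linarith
  have neg_of : ∀ w : Fin n → ℝ, (∀ s, 0 ≤ w s) → ∑ s, w s * (∑ i, d i * r s i) < 0 →
      ∃ s, ∑ i, d i * r s i < 0 := by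
    intro w hw hsum
    by_contra hc
    simp only [not_exists, not_lt] at hc
    have : 0 ≤ ∑ s, w s * (∑ i, d i * r s i) :=
      Finset.sum_nonneg (fun s _ => mul_nonneg (hw s) (hc s))
    linarith
  obtain ⟨w₁, hw₁, hw₁'⟩ := hspan t 1 (Or.inl rfl)
  obtain ⟨w₂, hw₂, hw₂'⟩ := hspan t (-1) (Or.inr rfl)
  have k₁ := key 1 w₁ hw₁'
  have k₂ := key (-1) w₂ hw₂'
  rcases lt_or_gt_of_ne ht' with hneg | hpos
  · -- d t < 0 : the representation of -e_t gives a positive pairing, that of +e_t a negative one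
    exact ⟨pos_of w₂ hw₂ (by rw [k₂]; linarith), neg_of w₁ hw₁ (by rw [k₁]; linarith)⟩
  · exact ⟨pos_of w₁ hw₁ (by rw [k₁]; linarith), neg_of w₂ hw₂ (by rw [k₂]; linarith)⟩

end Summit.NavierStokesRegularity.NavierStokesRegularity.Theorems
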